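import Mathlib

/-!
# Crux `RefutationDegree.BeyondHessianSos` (stmt-ValiantsHypothesis-5643), line `Sketch` —
# stub `stub_kneserProduct`: Kneser's theorem for coordinatewise products of subspaces

For subspaces `S, T` of the algebra `ι → ℂ` (coordinatewise multiplication; `S * T` is Mathlib's
product of submodules, the span of the pointwise products) there is a subspace `H` stabilising
`S * T` with `dim S + dim T ≤ dim (S * T) + dim H`.  This is Theorem 3.3 of D. Mirandola and
G. Zémor, *Critical pairs for the Product Singleton Bound*, IEEE Trans. Inform. Theory 61 (2015)
(Kneser's addition theorem, resp. the Hou–Leung–Xiang theorem, transposed to the algebra `K^n`),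
for `K = ℂ`.

Proof (the paper's §3, infinite-field case).
* Stabilisers are Mathlib's submodule quotients `V / V = {x | x V ⊆ V}`; annihilators are `⊥ / S`.
* A full-support subspace of `ι → ℂ` is spanned by its invertible (nowhere-vanishing) elements:
  a vector space over an infinite field is not a finite union of proper subspaces
  (`Submodule.exists_forall_notMem_of_forall_ne_top`).
* `e`-transform lemma (Lemma 3.6): `1 ∈ S`, `T` of full support ⟹ some `V` with `T ≤ V ≤ S * T`
  has `dim S + dim T ≤ dim V + dim (V / V)` (strong induction on `dim S` with `S ∩ T e⁻¹`,
  `T + S e`).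
* Subalgebras of `ι → ℂ` are spanned by the `0/1`-vectors they contain (Lagrange interpolation on
  level sets), so stabilisers range over a finite set; the finite-union lemma applied once more
  gives a spanning set of invertible elements of `S` with a common stabiliser algebra `H`, and
  then `H ≤ St(S * T)` (proof of Theorem 3.3).
* General `S, T` reduce to full support via `S ⊔ ⊥/S`, `T ⊔ ⊥/T` (a variant of Remark 3.5).
-/

set_option linter.dupNamespace false

noncomputable section

open scoped BigOperators
open Module Submodule

namespace Summit.ValiantsHypothesis.ValiantsHypothesis.Theorems.RefutationDegreeBeyondHessianSos

variable {ι : Type}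

/-- Multiplication by a nowhere-vanishing (= invertible) element `x` of `ι → ℂ` is (some)
linear automorphism (Mirandola–Zémor, Lemma 2.4). -/
private theorem exists_mulEquiv (x : ι → ℂ) (hx : ∀ i, x i ≠ 0) :
    ∃ φ : (ι → ℂ) ≃ₗ[ℂ] (ι → ℂ), ∀ v, φ v = x * v :=
  ⟨{ toFun := fun v => x * v, invFun := fun v => x⁻¹ * v, map_add' := mul_add x,
      map_smul' := fun c v => mul_smul_comm c x v,
      left_inv := fun v => by funext i; simp [hx i],
      right_inv := fun v => by funext i; simp [hx i] }, fun _ => rfl⟩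

/-- Over `ℂ`, a subspace of `ι → ℂ` with full support is spanned by its invertible elements
(Mirandola–Zémor, proof of Thm 3.3: `ℂ` is infinite, and a vector space over an infinite field is
not a finite union of proper subspaces). -/
private theorem le_span_units [Finite ι] {T : Submodule ℂ (ι → ℂ)} (hT : ∀ i, ∃ t ∈ T, t i ≠ 0) :
    T ≤ span ℂ {x | x ∈ T ∧ ∀ i, x i ≠ 0} := by
  intro t₀ ht₀
  by_contra h₀
  let p : Option ι → Submodule ℂ T := fun o =>
    o.elim ((span ℂ {x | x ∈ T ∧ ∀ i, x i ≠ 0}).comap T.subtype)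
      fun i => LinearMap.ker ((LinearMap.proj i).comp T.subtype)
  have hp : ∀ o, p o ≠ ⊤ := by
    rintro (_ | i) h
    · exact h₀ (by simpa [p] using Submodule.eq_top_iff'.1 h ⟨t₀, ht₀⟩)
    · obtain ⟨t, ht, hti⟩ := hT i
      exact hti (by simpa [p] using Submodule.eq_top_iff'.1 h ⟨t, ht⟩)
  obtain ⟨⟨x, hxT⟩, hx⟩ := Submodule.exists_forall_notMem_of_forall_ne_top p hp
  have hmem : x ∈ {x | x ∈ T ∧ ∀ i, x i ≠ 0} :=
    ⟨hxT, fun i hi => hx (some i) (by simpa [p] using hi)⟩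
  exact hx none (by simpa [p] using subset_span hmem)

/-- The `e`-transform lemma (Mirandola–Zémor 2015, Lemma 3.6, over `ℂ`): if `1 ∈ S` and `T` has
full support then some `V` with `T ≤ V ≤ S * T` satisfies `dim S + dim T ≤ dim V + dim St(V)`,
`St(V) = V / V` the stabiliser algebra of `V`.  Strong induction on `dim S`. -/
private theorem etransform [Finite ι] (n : ℕ) : ∀ S T : Submodule ℂ (ι → ℂ), finrank ℂ S = n →
    (1 : ι → ℂ) ∈ S → (∀ i, ∃ t ∈ T, t i ≠ 0) → ∃ V : Submodule ℂ (ι → ℂ),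
      T ≤ V ∧ V ≤ S * T ∧ finrank ℂ S + finrank ℂ T ≤ finrank ℂ V + finrank ℂ ↥(V / V) := by
  induction n using Nat.strong_induction_on with
  | _ n ih =>
  rintro S T rfl h1 hT
  have hTST : T ≤ S * T := fun t ht => by simpa using mul_mem_mul h1 ht
  by_cases hA : ∀ e ∈ T, (∀ i, e i ≠ 0) → ∀ s ∈ S, e * s ∈ T
  · -- every invertible `e ∈ T` has `S e ⊆ T`, so `S * T ⊆ T` and `S ≤ St(T)`: take `V := T`
    refine ⟨T, le_rfl, hTST, ?_⟩
    have hST : S ≤ T / T := fun s hs t ht => by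
      refine Submodule.span_induction (p := fun t _ => s * t ∈ T) (fun e he => ?_) (by simp)
        (fun a b _ _ ha hb => ?_) (fun c a _ ha => ?_) (le_span_units hT ht)
      · rw [mul_comm]; exact hA e he.1 he.2 s hs
      · rw [mul_add]; exact add_mem ha hb
      · rw [mul_smul_comm]; exact smul_mem _ c ha
    have := Submodule.finrank_mono hST
    omega
  · -- some invertible `e ∈ T` has `S(e) := S ∩ T e⁻¹ ⊊ S`: induct with `T(e) := T + S e`
    push Not at hA
    obtain ⟨e, heT, he, s, hs, hes⟩ := hA
    obtain ⟨φ, hφ⟩ := exists_mulEquiv e he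
    have hlt : S ⊓ T.comap (φ : (ι → ℂ) →ₗ[ℂ] (ι → ℂ)) < S :=
      lt_of_le_of_ne inf_le_left fun h => hes (by simpa [hφ] using (h.ge hs).2)
    have h1' : (1 : ι → ℂ) ∈ S ⊓ T.comap (φ : (ι → ℂ) →ₗ[ℂ] (ι → ℂ)) :=
      ⟨h1, by simpa [hφ] using heT⟩
    have hT' : ∀ i, ∃ t ∈ T ⊔ S.map (φ : (ι → ℂ) →ₗ[ℂ] (ι → ℂ)), t i ≠ 0 := fun i =>
      (hT i).imp fun t ht => ⟨mem_sup_left ht.1, ht.2⟩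
    obtain ⟨V, hTV, hVST, hdim⟩ :=
      ih _ (Submodule.finrank_lt_finrank_of_lt hlt) _ _ rfl h1' hT'
    refine ⟨V, le_sup_left.trans hTV, hVST.trans (mul_le.2 ?_), ?_⟩
    · rintro a ⟨haS, haT⟩ b hb
      obtain ⟨t, ht, c, ⟨s₀, hs₀, rfl⟩, rfl⟩ := mem_sup.1 hb
      rw [mul_add]
      refine add_mem (mul_mem_mul haS ht) ?_
      have haT' : e * a ∈ T := by simpa [hφ] using Submodule.mem_comap.1 haT
      have : a * (φ : (ι → ℂ) →ₗ[ℂ] (ι → ℂ)) s₀ = s₀ * (e * a) := by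
        rw [LinearEquiv.coe_coe, hφ]; ring
      rw [this]
      exact mul_mem_mul hs₀ haT'
    · have h2 : S.map (φ : (ι → ℂ) →ₗ[ℂ] (ι → ℂ)) ⊓ T =
          (S ⊓ T.comap (φ : (ι → ℂ) →ₗ[ℂ] (ι → ℂ))).map (φ : (ι → ℂ) →ₗ[ℂ] (ι → ℂ)) := by
        rw [Submodule.map_inf _ φ.injective, Submodule.map_comap_eq_of_surjective φ.surjective]
      have h3 := Submodule.finrank_sup_add_finrank_inf_eq T (S.map (φ : (ι → ℂ) →ₗ[ℂ] (ι → ℂ)))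
      rw [inf_comm, h2, LinearEquiv.finrank_map_eq, LinearEquiv.finrank_map_eq] at h3
      omega

/-- Lemma 3.6 of Mirandola–Zémor for an arbitrary invertible `x ∈ S` (apply `etransform` to
`x⁻¹ S` and multiply back by `x`): some `V` with `x T ⊆ V ⊆ S * T` has
`dim S + dim T ≤ dim V + dim St(V)`. -/
private theorem etransform' [Finite ι] {S T : Submodule ℂ (ι → ℂ)} {x : ι → ℂ} (hxS : x ∈ S)
    (hx : ∀ i, x i ≠ 0) (hT : ∀ i, ∃ t ∈ T, t i ≠ 0) : ∃ V : Submodule ℂ (ι → ℂ),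
      (∀ t ∈ T, x * t ∈ V) ∧ V ≤ S * T ∧
        finrank ℂ S + finrank ℂ T ≤ finrank ℂ V + finrank ℂ ↥(V / V) := by
  obtain ⟨φ, hφ⟩ := exists_mulEquiv x hx
  obtain ⟨V, hTV, hVST, hdim⟩ := etransform _ (S.comap (φ : (ι → ℂ) →ₗ[ℂ] (ι → ℂ))) T rfl
    (by simpa [hφ] using hxS) hT
  refine ⟨V.map (φ : (ι → ℂ) →ₗ[ℂ] (ι → ℂ)), fun t ht => ⟨t, hTV ht, hφ t⟩, ?_, ?_⟩
  · rw [Submodule.map_le_iff_le_comap]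
    refine hVST.trans (mul_le.2 fun a ha t ht => ?_)
    simpa [hφ, mul_assoc] using mul_mem_mul (Submodule.mem_comap.1 ha) ht
  · have h1 := LinearEquiv.finrank_map_eq φ.symm S
    rw [← Submodule.comap_equiv_eq_map_symm] at h1
    have h2 : V / V ≤ V.map (φ : (ι → ℂ) →ₗ[ℂ] (ι → ℂ)) / V.map (φ : (ι → ℂ) →ₗ[ℂ] (ι → ℂ)) := by
      rintro y hy _ ⟨v, hv, rfl⟩
      exact ⟨y * v, hy v hv, by simp only [LinearEquiv.coe_coe, hφ]; ring⟩
    have h3 := Submodule.finrank_mono h2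
    rw [LinearEquiv.finrank_map_eq]
    omega

/-- A stabiliser is spanned by the projectors it contains (Mirandola–Zémor, Lemma 2.7 / Remark 2.8:
a subalgebra of `K^n` has a basis of projectors, so there are finitely many subalgebras; here via
Lagrange interpolation on the level sets of its elements).  Hence `V / V` only depends on its
*profile* `{q | 𝟙_q ∈ V / V}`, an element of the finite type `Set (Set ι)`. -/
private theorem div_self_eq_span [Fintype ι] (V : Submodule ℂ (ι → ℂ)) : V / V =
    span ℂ ((fun q : Set ι => q.indicator (1 : ι → ℂ)) ''
      {q | q.indicator (1 : ι → ℂ) ∈ V / V}) := by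
  refine le_antisymm (fun f hf => ?_) (span_le.2 ?_)
  swap
  · rintro _ ⟨q, hq, rfl⟩
    exact hq
  have h1 : (1 : ι → ℂ) ∈ V / V := by simp
  have hmul : ∀ a b, a ∈ V / V → b ∈ V / V → a * b ∈ V / V := fun a b ha hb v hv => by
    rw [mul_assoc]
    exact ha _ (hb _ hv)
  -- the projector onto a level set of `f` is a polynomial in `f` (Lagrange interpolation)
  have key : ∀ c : ℂ, Set.indicator {i | f i = c} (1 : ι → ℂ) ∈ V / V := by
    intro c
    have : Set.indicator {i | f i = c} (1 : ι → ℂ) =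
        ∏ d ∈ (Finset.univ.image f).erase c, (c - d)⁻¹ • (f - d • (1 : ι → ℂ)) := by
      funext i
      rw [Finset.prod_apply]
      by_cases h : f i = c
      · rw [Finset.prod_eq_one]
        · simp [h]
        · intro d hd
          have : c - d ≠ 0 := sub_ne_zero.2 (Finset.ne_of_mem_erase hd).symm
          simp [h, this]
      · rw [Finset.prod_eq_zero (i := f i) (by simp [h]) (by simp)]
        simp [h]
    rw [this]
    exact Finset.prod_induction _ (· ∈ V / V) hmul h1 fun d _ =>
      smul_mem _ _ (sub_mem hf (smul_mem _ _ h1))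
  have hf' : f = ∑ c ∈ Finset.univ.image f, c • Set.indicator {i | f i = c} (1 : ι → ℂ) := by
    funext i
    simp [Finset.sum_apply, Set.indicator_apply]
  rw [hf']
  exact sum_mem fun c _ => smul_mem _ _ (subset_span ⟨_, key c, rfl⟩)

/-- Theorem 3.3 of Mirandola–Zémor for `S ≠ ⊥` and `S, T` of full support: pigeonhole the
invertible elements of `S` by the profile of the stabiliser of their `V_x` (Lemma 3.6); by the
finite-union lemma one class spans `S`, and its common stabiliser algebra `H` stabilises `S * T`. -/
private theorem kneser_fullSupp [Fintype ι] {S T : Submodule ℂ (ι → ℂ)} (hS : ∀ i, ∃ s ∈ S, s i ≠ 0)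
    (hT : ∀ i, ∃ t ∈ T, t i ≠ 0) (hS0 : S ≠ ⊥) : ∃ H : Submodule ℂ (ι → ℂ),
      H * (S * T) ≤ S * T ∧ finrank ℂ S + finrank ℂ T ≤ finrank ℂ ↥(S * T) + finrank ℂ H := by
  -- `D 𝒬`: the (invertible) `x ∈ S` admitting a `V_x` as in Lemma 3.6 with profile `𝒬`
  let D : Set (Set ι) → Set (ι → ℂ) := fun 𝒬 => {x | x ∈ S ∧ ∃ V : Submodule ℂ (ι → ℂ),
    (∀ t ∈ T, x * t ∈ V) ∧ V ≤ S * T ∧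
      finrank ℂ S + finrank ℂ T ≤ finrank ℂ V + finrank ℂ ↥(V / V) ∧
        {q : Set ι | q.indicator (1 : ι → ℂ) ∈ V / V} = 𝒬}
  let p : Set (Set ι) ⊕ ι → Submodule ℂ S :=
    Sum.elim (fun 𝒬 => (span ℂ (D 𝒬)).comap S.subtype)
      fun i => LinearMap.ker ((LinearMap.proj i).comp S.subtype)
  obtain ⟨j, hj⟩ : ∃ j, p j = ⊤ := by
    by_contra! h
    obtain ⟨⟨x, hxS⟩, hx⟩ := Submodule.exists_forall_notMem_of_forall_ne_top p h
    have hxu : ∀ i, x i ≠ 0 := fun i hi => hx (Sum.inr i) (by simpa [p] using hi)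
    obtain ⟨V, hV1, hV2, hV3⟩ := etransform' hxS hxu hT
    have hxD : x ∈ D {q : Set ι | q.indicator (1 : ι → ℂ) ∈ V / V} := ⟨hxS, V, hV1, hV2, hV3, rfl⟩
    exact hx (Sum.inl _) (by simpa [p] using subset_span hxD)
  rcases j with 𝒬 | i
  swap
  · obtain ⟨s, hs, hsi⟩ := hS i
    exact absurd (by simpa [p] using Submodule.eq_top_iff'.1 hj ⟨s, hs⟩) hsi
  have hSD : S ≤ span ℂ (D 𝒬) := fun s hs => by
    simpa [p] using Submodule.eq_top_iff'.1 hj ⟨s, hs⟩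
  obtain ⟨x, -, V, -, hV2, hV3, hV4⟩ : (D 𝒬).Nonempty := by
    by_contra h
    rw [Set.not_nonempty_iff_eq_empty] at h
    rw [h, span_empty, le_bot_iff] at hSD
    exact hS0 hSD
  refine ⟨span ℂ ((fun q : Set ι => q.indicator (1 : ι → ℂ)) '' 𝒬),
    mul_le.2 fun g hg w hw => ?_, ?_⟩
  · refine Submodule.mul_induction_on hw (fun s hs t ht => ?_) fun a b ha hb => ?_
    swap
    · rw [mul_add]
      exact add_mem ha hb
    refine Submodule.span_induction (p := fun s _ => g * (s * t) ∈ S * T) (fun y hy => ?_)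
      (by simp) (fun a b _ _ ha hb => ?_) (fun c a _ ha => ?_) (hSD hs)
    · obtain ⟨-, V', h1', h2', -, h4'⟩ := hy
      have hg' : g ∈ V' / V' := by
        rw [div_self_eq_span, h4']
        exact hg
      exact h2' (hg' _ (h1' t ht))
    · rw [add_mul, mul_add]
      exact add_mem ha hb
    · rw [smul_mul_assoc, mul_smul_comm]
      exact smul_mem _ c ha
  · have e1 := Submodule.finrank_mono hV2
    have e2 : finrank ℂ ↥(V / V) =
        finrank ℂ (span ℂ ((fun q : Set ι => q.indicator (1 : ι → ℂ)) '' 𝒬)) := by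
      rw [div_self_eq_span, hV4]
    omega

/-- `S ⊔ ⊥/S` has full support (`⊥ / S`, the annihilator of `S`, is the space of vectors vanishing
on the support of `S`; cf. Mirandola–Zémor, Remark 3.5). -/
private theorem fullSupp_sup_ann [DecidableEq ι] (S : Submodule ℂ (ι → ℂ)) (i : ι) :
    ∃ s ∈ S ⊔ ⊥ / S, s i ≠ 0 := by
  by_cases h : ∃ s ∈ S, s i ≠ 0
  · obtain ⟨s, hs, hsi⟩ := h
    exact ⟨s, mem_sup_left hs, hsi⟩
  push Not at h
  refine ⟨Pi.single i 1, mem_sup_right fun s hs => ?_, by simp⟩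
  rw [mem_bot]
  funext j
  by_cases hj : j = i
  · subst hj
    simp [h s hs]
  · simp [hj]

/-- `S ∩ ⊥/S = 0`, as `ι → ℂ` is reduced. -/
private theorem inf_ann_eq_bot (S : Submodule ℂ (ι → ℂ)) : S ⊓ ⊥ / S = ⊥ := by
  rw [eq_bot_iff]
  rintro s ⟨hs, hs'⟩
  have h : s * s = 0 := (mem_bot ℂ).1 (hs' s hs)
  rw [mem_bot]
  funext i
  simpa using congrFun h i

/-- **Stub `stub_kneserProduct`: Kneser's theorem for coordinatewise products** (D. Mirandola,
G. Zémor, *Critical pairs for the Product Singleton Bound*, IEEE Trans. Inform. Theory 61 (2015),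
Theorem 3.3, for the field `ℂ`).  For subspaces `S, T ⊆ ℂ^ι` of the algebra `ι → ℂ` with
coordinatewise multiplication, `S * T` the span of the pointwise products, there is a subspace `H`
with `H · (S * T) ⊆ S * T` (i.e. `H` lies in the stabiliser algebra `St(S * T)`) and
`dim S + dim T ≤ dim (S * T) + dim H`; equivalently `dim S T ≥ dim S + dim T - dim St(S T)`.
(For `S = ⊥` take `H = ⊤`; otherwise reduce to full support by `S ⊔ ⊥/S`, `T ⊔ ⊥/T` and use
`kneser_fullSupp`.) -/
theorem stub_kneserProduct {ι : Type} [Fintype ι] [DecidableEq ι] (S T : Submodule ℂ (ι → ℂ)) :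
    ∃ H : Submodule ℂ (ι → ℂ), (∀ x ∈ H, ∀ v ∈ S * T, x * v ∈ S * T) ∧
      Module.finrank ℂ S + Module.finrank ℂ T ≤
        Module.finrank ℂ ↥(S * T) + Module.finrank ℂ H := by
  by_cases h0 : S = ⊥
  · subst h0
    refine ⟨⊤, fun x _ v hv => ?_, ?_⟩
    · rw [bot_mul, mem_bot] at hv ⊢
      simp [hv]
    · have := Submodule.finrank_le T
      simp only [finrank_bot, finrank_top, zero_add]
      omega
  -- ideals `⊥ / N` (annihilators) absorb products
  have hI : ∀ N X : Submodule ℂ (ι → ℂ), X * (⊥ / N) ≤ ⊥ / N := fun N X =>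
    mul_le.2 fun x _ m hm n hn => by
      rw [mem_bot, mul_assoc, (mem_bot ℂ).1 (hm n hn), mul_zero]
  have hc : (S ⊔ ⊥ / S) * (T ⊔ ⊥ / T) ≤ S * T ⊔ (⊥ / S ⊔ ⊥ / T) := by
    rw [Submodule.sup_mul, Submodule.mul_sup]
    refine sup_le (sup_le le_sup_left ((hI T S).trans ?_)) ?_
    · exact le_sup_right.trans le_sup_right
    · rw [Submodule.mul_comm]
      exact (hI S _).trans (le_sup_left.trans le_sup_right)
  have hAnn : ∀ v ∈ S * T, ∀ m ∈ ⊥ / S ⊔ ⊥ / T, v * m = 0 := by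
    intro v hv m hm
    obtain ⟨a, ha, b, hb, rfl⟩ := mem_sup.1 hm
    refine Submodule.mul_induction_on hv (fun s hs t ht => ?_) fun _ _ h h' => by
      rw [add_mul, h, h', add_zero]
    have h1 : a * s = 0 := (mem_bot ℂ).1 (ha s hs)
    have h2 : b * t = 0 := (mem_bot ℂ).1 (hb t ht)
    calc s * t * (a + b) = t * (a * s) + s * (b * t) := by ring
      _ = 0 := by rw [h1, h2]; simp
  have hS'0 : S ⊔ ⊥ / S ≠ ⊥ := fun h => h0 (le_bot_iff.1 (le_sup_left.trans h.le))
  obtain ⟨H, hH, hdim⟩ := kneser_fullSupp (fullSupp_sup_ann S) (fullSupp_sup_ann T) hS'0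
  refine ⟨H, fun x hx v hv => ?_, ?_⟩
  · -- `x v ∈ S T + (⊥/S + ⊥/T)`; the second component `m` has `m² = 0`, hence vanishes
    have hxv : x * v ∈ S * T ⊔ (⊥ / S ⊔ ⊥ / T) :=
      hc (mul_le.1 hH x hx v
        ((mul_le_mul' le_sup_left le_sup_left : S * T ≤ (S ⊔ ⊥ / S) * (T ⊔ ⊥ / T)) hv))
    obtain ⟨w, hw, m, hm, hwm⟩ := mem_sup.1 hxv
    have hm0 : m * m = 0 := by
      calc m * m = (x * v - w) * m := by rw [← hwm]; ring
        _ = 0 := by rw [sub_mul, mul_assoc, hAnn v hv m hm, hAnn w hw m hm]; simp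
    have : m = 0 := funext fun i => by simpa using congrFun hm0 i
    rw [this, add_zero] at hwm
    exact hwm ▸ hw
  · have e1 := Submodule.finrank_sup_add_finrank_inf_eq S (⊥ / S)
    have e2 := Submodule.finrank_sup_add_finrank_inf_eq T (⊥ / T)
    rw [inf_ann_eq_bot, finrank_bot] at e1 e2
    have e3 := Submodule.finrank_mono hc
    have e4 := Submodule.finrank_add_le_finrank_add_finrank (S * T) (⊥ / S ⊔ ⊥ / T)
    have e5 := Submodule.finrank_add_le_finrank_add_finrank (⊥ / S) (⊥ / T)
    omega

end Summit.ValiantsHypothesis.ValiantsHypothesis.Theorems.RefutationDegreeBeyondHessianSos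

end
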